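import Literature.Geometry.Riemannian.ShrinkerDistanceComparisonCutoff
import Literature.Geometry.Riemannian.ShrinkerPotentialGrowthProofs
import Literature.Geometry.Riemannian.VolumeSphereTheoremJacobiFrameProofs
import Literature.Geometry.Riemannian.BakryEmeryHeatFlow
import HarnessLib

/-!
# Zhang's weighted Laplacian comparison for the distance on a gradient shrinker, along geodesic
# directions (Zhang 2009, Prop. 2.2 (ii)), part 2: along one geodesic, then at every far point

The geometric half of Z.-H. Zhang's proof that complete
gradient shrinking Ricci solitons have `R ≥ 0` (Proc. AMS 137 (2009), Thm. 1.3 (ii), proof, Step 1;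
Wei–Wylie's `f`-Laplacian comparison). For a complete connected gradient shrinker
`Ric + Hess f = g/2` and a base point `p` there is `C = C(p)` such that at every `x₀` with
`d(p, x₀) ≥ 1` the following SECOND-ORDER UPPER BARRIERS for `d(p, ·)` along geodesic directions
exist: a `g`-orthonormal frame `e` of `T_{x₀}M` headed by the direction `e none = γ̇(T)` of a unit
speed minimizing geodesic `γ` from `p` to `x₀ = γ(T)`, and reals `q_o`, with
`d(p, exp_{x₀}(s e_o)) ≤ d(p, x₀) + [o = none] s + q_o s²` for `s` near `0` and
`2 Σ_o q_o − df(e none) ≤ C`.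

Proof: Hopf–Rinow (`exists_isMinimizingUpTo_of_isGeodesicallyComplete`); a `g`-orthonormal frame at
`x₀` headed by `γ̇(T)` (`exists_orthonormal_frame_with_head`), transported parallel along `γ`
(`exists_parallel_orthonormal_frame_Ioo'`); the variation fields `X_o = φ E_o` with the cut-off
`φ(t) = χ(t) χ(2T + 1 − 2t)`, `χ = Real.smoothTransition` (`φ(0) = 0`, `φ = 1` on `[1, T]`); the
tree's distance barrier `HaslhoferMuller.edist_toReal_le_taylor` (second variation of energy +
`d² ≤ T·Energy`) for each `X_o`, giving `q_o = (Q_o + εT)/2`, `Q_o = ∫₀ᵀ g(R(X_o,γ̇)X_o,γ̇) + |X_o'|²`;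
the trace identity `Σ_o g(R(E_o,γ̇)E_o,γ̇) = −Ric(γ̇,γ̇)` (`sum_val_curvature_eq_ricci`,
`val_curvature_skew`); the soliton equation `Ric(γ̇,γ̇) = ½ − (f∘γ)''`; and ONE integration by
parts, in which the boundary term `(f∘γ)'(T) = df(e none)` is exactly the drift term of the
weighted Laplacian (the Wei–Wylie cancellation), leaving `∫₀¹ ((k+1)φ'² − 2φφ'(f∘γ)') − ½∫φ²`,
bounded by data on the compact unit ball about `p`.

§2 (`directionalComparison_core`) assembles the datum at EVERY point `x₀` with `d(p, x₀) ≥ 1` by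
Hopf–Rinow (`exists_isMinimizingUpTo_of_isGeodesicallyComplete`, unit speed reparametrisation) and
compactness of the closed unit ball about `p`, on which `|∇f|²` is bounded (`contMDiff_gradSq`) and
through which every minimizing segment from `p` runs during `[0, 1]`. First user: stub X_A
`stub_directionalComparison` of the crux `EntropyRung.NoncompactShrinkerGap` (Summits/SmoothPoincare4,
line `collapsed-ends-usc`, skeleton v6) — one half of the discharge of the named fact
`shrinkerScalarCurvature_nonneg` (`ShrinkerScalarCurvatureNonneg.lean`); the other half is the
localised minimum principle. Everything here is proved; no definitions, no named facts.

## References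

* Z.-H. Zhang, *On the completeness of gradient Ricci solitons*, Proc. AMS 137 (2009) 2755–2759,
  Prop. 2.2 (ii) and proof of Thm. 1.3, Step 1. [Zhang2009]
* G. Wei, W. Wylie, J. Differential Geom. 83 (2009) 377–405, Thm. 1.1 (a); J. M. Lee,
  *Introduction to Riemannian Manifolds* (2018), Thm. 10.22 (second variation).
-/

noncomputable section


open Bundle Set Function Filter MeasureTheory
open scoped Manifold ContDiff Topology ENNReal NNReal

namespace Literature.Geometry.Riemannian.Zhang2009

open Lorentzian Lorentzian.PseudoRiemannianMetric

/-! ### §1 The datum along one unit speed geodesic -/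

section Core

variable {E : Type*} [NormedAddCommGroup E] [NormedSpace ℝ E] [FiniteDimensional ℝ E]
  [CompleteSpace E] {M : Type*} [TopologicalSpace M] [ChartedSpace E M] [IsManifold 𝓘(ℝ, E) ∞ M]
  [T2Space M]
  (g : PseudoRiemannianMetric 𝓘(ℝ, E) ∞ E (TangentSpace 𝓘(ℝ, E) : M → Type _)) [g.HasLeviCivita]
  [CovariantDerivative.ContMDiffCovariantDerivative g.leviCivita 1]
  [CovariantDerivative.ContMDiffCovariantDerivative g.leviCivita ∞]

/-- **The directional comparison datum along a unit speed geodesic** `γ(t) = exp_p(tu)` at the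
parameter `T ≥ 1`: frame at `γ(T)` headed by `γ̇(T)`, barriers from `edist_toReal_le_taylor` for
the fields `φ_T E_o`, and the bound `2Σ q_o − df(γ̇(T)) ≤ dim·(3K)² + 6K√G₀ + 1`, where `K` bounds
`χ'` and `G₀` bounds `|∇f|²` on `γ[0, 1]`. [cite: Zhang2009, Prop. 2.2 (ii) and proof of Thm. 1.3, Step 1] -/
theorem datum_along (hg : g.IsRiemannian) (hc : IsGeodesicallyComplete g.leviCivita)
    {f : M → ℝ} (hf : ContMDiff 𝓘(ℝ, E) 𝓘(ℝ, ℝ) ∞ f)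
    (hsol : ∀ (x : M) (X Y : TangentSpace 𝓘(ℝ, E) x),
      g.ricci x X Y + g.hessian f x X Y = (1 / 2 : ℝ) * g.val x X Y)
    (p : M) (u : TangentSpace 𝓘(ℝ, E) p) (hu : g.val p u u = 1) {T : ℝ} (hT : 1 ≤ T)
    {K : ℝ} (hK : ∀ t : ℝ, |deriv Real.smoothTransition t| ≤ K)
    {G₀ : ℝ} (hG₀ : ∀ t ∈ Icc (0 : ℝ) 1, g.gradSq f (expMap g.leviCivita p (t • u)) ≤ G₀) :
    ∃ (k : ℕ) (e : Option (Fin k) → TangentSpace 𝓘(ℝ, E) (expMap g.leviCivita p (T • u)))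
      (q : Option (Fin k) → ℝ),
      Fintype.card (Option (Fin k)) = Module.finrank ℝ E ∧
      (∀ o o', g.val (expMap g.leviCivita p (T • u)) (e o) (e o') = if o = o' then 1 else 0) ∧
      2 * (∑ o, q o) - mvfderiv 𝓘(ℝ, E) f (expMap g.leviCivita p (T • u)) (e none) ≤
        Module.finrank ℝ E * (3 * K) ^ 2 + 6 * K * Real.sqrt G₀ + 1 ∧
      ∀ o, ∀ᶠ s in 𝓝 (0 : ℝ),
        (g.edist hg p (expMap g.leviCivita (expMap g.leviCivita p (T • u)) (s • e o))).toReal ≤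
          T + (if o = none then s else 0) + q o * s ^ 2 := by
  classical
  have hLC := PseudoRiemannianMetric.isLeviCivita_leviCivita_holds (g := g)
  have hreg : g.leviCivita.IsLocallyContMDiff ∞ := hLC.isLocallyContMDiff ⊤ (le_of_eq rfl)
  have h2 : (2 : ℕ∞ω) ≤ (∞ : ℕ∞ω) := WithTop.coe_le_coe.2 le_top
  haveI : Fact ((1 : ℕ∞ω) ≤ (∞ : ℕ∞ω)) := ⟨by exact_mod_cast le_top⟩
  have hTpos : 0 < T := by linarith
  -- the geodesic
  set γ : ℝ → M := fun t ↦ expMap g.leviCivita p (t • u) with hγ_def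
  have hgeo : IsGeodesic g.leviCivita γ := isGeodesic_expMap_smul_of_isGeodesicallyComplete hc p u
  have hγfun : γ = maximalGeodesic g.leviCivita p u := funext fun t ↦ expMap_smul hc p u t
  have hγs : ContMDiff 𝓘(ℝ, ℝ) 𝓘(ℝ, E) ∞ γ := by
    rw [hγfun]
    exact (contMDiff_maximalGeodesic_family hc p).comp
      (contMDiff_id.prodMk (contMDiff_const (c := (show E from u))))
  have hγd : ∀ t, MDifferentiableAt 𝓘(ℝ, ℝ) 𝓘(ℝ, E) γ t := fun t ↦
    mdifferentiableAt_of_mdifferentiableAt_lift (hgeo.1 t (mem_univ t))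
  have hγc : ∀ t, ContinuousAt (tangentLift 𝓘(ℝ, E) γ) t := fun t ↦
    (hgeo.1 t (mem_univ t)).continuousAt
  have hγ0 : γ 0 = p := by
    show expMap g.leviCivita p ((0 : ℝ) • u) = p
    rw [zero_smul]
    exact expMap_zero (cov := g.leviCivita) p
  -- unit speed
  have hspeed : ∀ t, g.val (γ t) (velocity 𝓘(ℝ, E) γ t) (velocity 𝓘(ℝ, E) γ t) = 1 := by
    intro t
    have h := g.val_velocity_eq_of_isGeodesicOn_holds isOpen_univ ordConnected_univ hgeo
      (mem_univ t) (mem_univ 0)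
    have hv0 : (velocity 𝓘(ℝ, E) γ 0 : E) = (u : E) := velocity_expMap_smul_zero p u
    rw [h, hv0, hγ0, hu]
  -- the bound `|(f ∘ γ)'| ≤ √G₀` on `[0, 1]` (Cauchy–Schwarz, unit speed)
  set G : ℝ := Real.sqrt G₀ with hG_def
  have hG : ∀ t ∈ Icc (0 : ℝ) 1, |mvfderiv 𝓘(ℝ, E) f (γ t) (velocity 𝓘(ℝ, E) γ t)| ≤ G := by
    intro t ht
    have h := abs_mvfderiv_le_sqrt_gradSq_mul_sqrt g hg f (γ t) (velocity 𝓘(ℝ, E) γ t)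
    rw [hspeed t, Real.sqrt_one, mul_one] at h
    exact h.trans (Real.sqrt_le_sqrt (hG₀ t ht))
  -- the frame at `γ T` headed by `γ̇ T`, transported along `γ` on `(-1, T + 1)`
  obtain ⟨k, f₀, hf₀none, hf₀on, hcard⟩ := exists_orthonormal_frame_with_head g hg (γ T) (hspeed T)
  have hT₀ : T ∈ Ioo (-1 : ℝ) (T + 1) := ⟨by linarith, by linarith⟩
  obtain ⟨e, he0, hepar, heon⟩ :=
    exists_parallel_orthonormal_frame_Ioo' g hg hLC.2 hreg hγd hγc hT₀ f₀ hf₀on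
  have helift : ∀ o, ∀ t ∈ Ioo (-1 : ℝ) (T + 1), ContMDiffAt 𝓘(ℝ, ℝ) 𝓘(ℝ, E).tangent ∞
      (fun t ↦ (TotalSpace.mk' E (γ t) (e o t) : TangentBundle 𝓘(ℝ, E) M)) t := fun o t ht ↦
    HaslhoferMuller.contMDiffAt_lift_of_isParallelAlongOn g.leviCivita hreg hγs isOpen_Ioo
      (hepar o) ht
  -- the cut-off and the variation fields `X_o = φ • e_o`
  obtain ⟨φ, hφs, hφ0', hφ1', hφneg, hφge, hφone, hφ'b, hφ'0⟩ := exists_cutoff hK T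
  set X : Option (Fin k) → Π t : ℝ, TangentSpace 𝓘(ℝ, E) (γ t) := fun o t ↦ φ t • e o t
    with hX_def
  have hzeroLift : ContMDiff 𝓘(ℝ, ℝ) 𝓘(ℝ, E).tangent ∞
      (fun t ↦ (TotalSpace.mk' E (γ t) (0 : TangentSpace 𝓘(ℝ, E) (γ t)) :
        TangentBundle 𝓘(ℝ, E) M)) :=
    (contMDiff_zeroSection ℝ (TangentSpace 𝓘(ℝ, E) : M → Type _)).comp hγs
  have hXs : ∀ o, ContMDiff 𝓘(ℝ, ℝ) 𝓘(ℝ, E).tangent ∞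
      (fun t ↦ (TotalSpace.mk' E (γ t) (X o t) : TangentBundle 𝓘(ℝ, E) M)) := by
    intro o t
    by_cases ht : t ∈ Ioo (-1 : ℝ) (T + 1)
    · exact contMDiffAt_liftAlong_smul (helift o t ht) (hφs.contDiffAt.contMDiffAt)
    · -- `φ` vanishes near `t`, so the field is the zero section there
      refine (hzeroLift t).congr_of_eventuallyEq ?_
      rcases le_or_gt t (-1) with hle | hgt
      · filter_upwards [(isOpen_gt' (0 : ℝ)).mem_nhds (show t < 0 by linarith)] with s hs
        show (TotalSpace.mk' E (γ s) (X o s) : TangentBundle 𝓘(ℝ, E) M) =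
          TotalSpace.mk' E (γ s) (0 : TangentSpace 𝓘(ℝ, E) (γ s))
        rw [hX_def]
        simp only [hφneg s (le_of_lt hs), zero_smul]
      · have hge : T + 1 ≤ t := by
          by_contra hlt
          exact ht ⟨hgt, lt_of_not_ge hlt⟩
        filter_upwards [(isOpen_lt' (T + 1 / 2)).mem_nhds (show T + 1 / 2 < t by linarith)]
          with s hs
        show (TotalSpace.mk' E (γ s) (X o s) : TangentBundle 𝓘(ℝ, E) M) =
          TotalSpace.mk' E (γ s) (0 : TangentSpace 𝓘(ℝ, E) (γ s))
        rw [hX_def]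
        simp only [hφge s (le_of_lt hs), zero_smul]
  have hX0 : ∀ o, X o 0 = 0 := fun o ↦ by
    show φ 0 • e o 0 = 0
    rw [hφneg 0 le_rfl, zero_smul]
  have hXT : ∀ o, X o T = f₀ o := fun o ↦ by
    show φ T • e o T = f₀ o
    rw [hφone T hT le_rfl, one_smul, he0]
  -- the index integrands and their integrals
  set qf : Option (Fin k) → ℝ → ℝ := fun o t ↦
    g.val (γ t) (g.leviCivita.curvature (γ t) (X o t) (velocity 𝓘(ℝ, E) γ t) (X o t))
        (velocity 𝓘(ℝ, E) γ t) +
      g.val (γ t) (covariantDerivAlong g.leviCivita γ (X o) t)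
        (covariantDerivAlong g.leviCivita γ (X o) t) with hqf_def
  have hqfc : ∀ o, Continuous (qf o) := fun o ↦
    (integral_energy_le_taylor g le_rfl hc (hXs o) hTpos.le).1
  set Q : Option (Fin k) → ℝ := fun o ↦ ∫ t in (0 : ℝ)..T, qf o t with hQ_def
  -- the barrier for each direction
  set ε : ℝ := 1 / ((Fintype.card (Option (Fin k)) : ℝ) * T) with hε_def
  have hcardpos : 0 < (Fintype.card (Option (Fin k)) : ℝ) := by
    exact_mod_cast Fintype.card_pos
  have hε : 0 < ε := by positivity
  have hbar : ∀ o, ∀ᶠ s in 𝓝 (0 : ℝ),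
      (g.edist hg p (expMap g.leviCivita (expMap g.leviCivita p (T • u)) (s • f₀ o))).toReal ≤
        T + (if o = none then s else 0) + (Q o + ε * T) / 2 * s ^ 2 := by
    intro o
    obtain ⟨δ, hδ, hδ'⟩ :=
      HaslhoferMuller.edist_toReal_le_taylor g le_rfl hg hc p u hu (hXs o) (hX0 o) hTpos ε hε
    filter_upwards [Icc_mem_nhds (show -δ < 0 by linarith) hδ] with s hs
    have h := hδ' s hs
    have ha : g.val (expMap g.leviCivita p (T • u)) (f₀ o)
        (velocity 𝓘(ℝ, E) (fun t ↦ expMap g.leviCivita p (t • u)) T) =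
        if o = none then 1 else 0 := by
      show g.val (γ T) (f₀ o) (velocity 𝓘(ℝ, E) γ T) = _
      rw [← hf₀none, hf₀on]
    rw [hXT] at h
    rw [ha] at h
    have hif : s * (if o = none then (1 : ℝ) else 0) = if o = none then s else 0 := by
      split_ifs <;> simp
    calc (g.edist hg p (expMap g.leviCivita (expMap g.leviCivita p (T • u)) (s • f₀ o))).toReal
        ≤ T + s * (if o = none then (1 : ℝ) else 0) + s ^ 2 * ((Q o) + ε * T) / 2 := h
      _ = T + (if o = none then s else 0) + (Q o + ε * T) / 2 * s ^ 2 := by rw [hif]; ring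
  -- the potential along the geodesic and its first two derivatives (as in `hm_distance_bound`)
  set F : ℝ → ℝ := fun t ↦ f (γ t) with hF_def
  set F₁ : ℝ → ℝ := fun t ↦ mvfderiv 𝓘(ℝ, E) f (γ t) (velocity 𝓘(ℝ, E) γ t) with hF₁_def
  set F₂ : ℝ → ℝ := fun t ↦ g.hessian f (γ t) (velocity 𝓘(ℝ, E) γ t) (velocity 𝓘(ℝ, E) γ t)
    with hF₂_def
  have hFd : ∀ t, HasDerivAt F (F₁ t) t := fun t ↦
    hasDerivAt_comp_curve_mvfderiv ((hf _).mdifferentiableAt (by simp)) (hγd t)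
  have hF₁d : ∀ t, HasDerivAt F₁ (F₂ t) t := fun t ↦
    g.hasDerivAt_mvfderiv_velocity_of_isGeodesicOn hgeo (mem_univ t) ((hf _).of_le h2)
  have hFs : ContDiff ℝ ∞ F := (hf.comp hγs).contDiff
  have hdF : deriv F = F₁ := funext fun t ↦ (hFd t).deriv
  have hdF₁ : deriv F₁ = F₂ := funext fun t ↦ (hF₁d t).deriv
  have hF₁s : ContDiff ℝ ∞ F₁ := hdF ▸ (contDiff_infty_iff_deriv.mp hFs).2
  have hF₂s : ContDiff ℝ ∞ F₂ := hdF₁ ▸ (contDiff_infty_iff_deriv.mp hF₁s).2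
  have hF₁c : Continuous F₁ := hF₁s.continuous
  have hF₂c : Continuous F₂ := hF₂s.continuous
  -- the Ricci curvature along the geodesic: `Ric(γ̇, γ̇) = ½ - F''`
  have hρ : ∀ t, g.leviCivita.ricci (γ t) (velocity 𝓘(ℝ, E) γ t) (velocity 𝓘(ℝ, E) γ t) =
      1 / 2 - F₂ t := by
    intro t
    have h := hsol (γ t) (velocity 𝓘(ℝ, E) γ t) (velocity 𝓘(ℝ, E) γ t)
    rw [hspeed t, mul_one] at h
    have h' : g.leviCivita.ricci (γ t) (velocity 𝓘(ℝ, E) γ t) (velocity 𝓘(ℝ, E) γ t) + F₂ t =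
        1 / 2 := h
    linarith
  -- derivative of the cut-off
  have hφd : ∀ t, DifferentiableAt ℝ φ t := fun t ↦ (hφs.differentiable (by simp)).differentiableAt
  have hφ'c : Continuous (deriv φ) := hφs.continuous_deriv (by simp)
  have hφc : Continuous φ := hφs.continuous
  -- (A) the index integrand of `X_o` in the frame, on the interval
  have hqf : ∀ o, ∀ t ∈ Ioo (-1 : ℝ) (T + 1), qf o t =
      -(φ t ^ 2 * g.val (γ t) (g.leviCivita.curvature (γ t) (e o t) (velocity 𝓘(ℝ, E) γ t)
        (velocity 𝓘(ℝ, E) γ t)) (e o t)) + deriv φ t ^ 2 := by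
    intro o t ht
    have hD : covariantDerivAlong g.leviCivita γ (X o) t = deriv φ t • e o t := by
      have h := covariantDerivAlong_smul_holds g.leviCivita (γ := γ) (W := e o) (f := φ) (t₀ := t)
        (hφd t) (hepar o t ht).1
      rw [(hepar o t ht).2, smul_zero, add_zero] at h
      exact h
    have hcurv : g.val (γ t) (g.leviCivita.curvature (γ t) (X o t) (velocity 𝓘(ℝ, E) γ t) (X o t))
        (velocity 𝓘(ℝ, E) γ t) = φ t ^ 2 * g.val (γ t) (g.leviCivita.curvature (γ t) (e o t)
          (velocity 𝓘(ℝ, E) γ t) (e o t)) (velocity 𝓘(ℝ, E) γ t) := by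
      show g.val (γ t) (g.leviCivita.curvature (γ t) (φ t • e o t) (velocity 𝓘(ℝ, E) γ t)
        (φ t • e o t)) (velocity 𝓘(ℝ, E) γ t) = _
      simp only [map_smul, FunLike.coe_smul, Pi.smul_apply, smul_eq_mul]
      ring
    have hskew := hLC.val_curvature_skew h2 (γ t) (e o t) (velocity 𝓘(ℝ, E) γ t) (e o t)
      (velocity 𝓘(ℝ, E) γ t)
    have hDD : g.val (γ t) (covariantDerivAlong g.leviCivita γ (X o) t)
        (covariantDerivAlong g.leviCivita γ (X o) t) = deriv φ t ^ 2 := by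
      rw [hD]
      simp only [map_smul, FunLike.coe_smul, Pi.smul_apply, smul_eq_mul]
      rw [heon t ht o o, if_pos rfl]
      ring
    show g.val (γ t) (g.leviCivita.curvature (γ t) (X o t) (velocity 𝓘(ℝ, E) γ t) (X o t))
        (velocity 𝓘(ℝ, E) γ t) + g.val (γ t) (covariantDerivAlong g.leviCivita γ (X o) t)
        (covariantDerivAlong g.leviCivita γ (X o) t) = _
    rw [hcurv, hDD, hskew]
    ring
  -- (B) summing over the frame: `Σ_o q_o = -φ² Ric(γ̇,γ̇) + card · φ'²`
  set w : ℝ → ℝ := fun t ↦ -(φ t ^ 2 * (1 / 2 - F₂ t)) +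
    (Fintype.card (Option (Fin k)) : ℝ) * deriv φ t ^ 2 with hw_def
  have hsum : ∀ t ∈ Ioo (-1 : ℝ) (T + 1), ∑ o, qf o t = w t := by
    intro t ht
    have hric := sum_val_curvature_eq_ricci g g.leviCivita (γ t) (heon t ht) hcard
      (velocity 𝓘(ℝ, E) γ t)
    rw [Finset.sum_congr rfl fun o _ ↦ hqf o t ht, Finset.sum_add_distrib, Finset.sum_const,
      Finset.card_univ, nsmul_eq_mul, Finset.sum_neg_distrib, ← Finset.mul_sum, hric, hρ t]
  -- (D) the integrals
  have hIoo : uIcc (0 : ℝ) T ⊆ Ioo (-1 : ℝ) (T + 1) := by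
    rw [uIcc_of_le hTpos.le]
    exact fun t ht ↦ ⟨by linarith [ht.1], by linarith [ht.2]⟩
  have hsumQ : ∑ o, Q o = ∫ t in (0 : ℝ)..T, w t := by
    have h1 : ∑ o, Q o = ∫ t in (0 : ℝ)..T, ∑ o, qf o t := by
      rw [intervalIntegral.integral_finsetSum]
      exact fun o _ ↦ (hqfc o).intervalIntegrable _ _
    rw [h1]
    exact intervalIntegral.integral_congr fun t ht ↦ hsum t (hIoo ht)
  -- (E) the real-variable bound
  have hbound : (∫ t in (0 : ℝ)..T, w t) - F₁ T ≤
      (Fintype.card (Option (Fin k)) : ℝ) * (3 * K) ^ 2 + 6 * K * G := by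
    have hφabs : ∀ t, |φ t| ≤ 1 := fun t ↦ by
      rw [abs_of_nonneg (hφ0' t)]
      exact hφ1' t
    exact cutoff_integral_bound hT hcardpos.le hφd hφc hφ'c hF₁c hF₂c hF₁d hφabs hφ'b hφ'0
      (hφneg 0 le_rfl) (hφone T hT le_rfl) hG
  -- (F) assembly
  refine ⟨k, f₀, fun o ↦ (Q o + ε * T) / 2, hcard, hf₀on, ?_, hbar⟩
  have hF₁T : mvfderiv 𝓘(ℝ, E) f (expMap g.leviCivita p (T • u)) (f₀ none) = F₁ T := by
    show mvfderiv 𝓘(ℝ, E) f (γ T) (f₀ none) = _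
    rw [hf₀none]
  have hs2 : 2 * ∑ o, (Q o + ε * T) / 2 = ∑ o, Q o + 1 := by
    have hcardT : (Fintype.card (Option (Fin k)) : ℝ) * (ε * T) = 1 := by
      have hne : (Fintype.card (Option (Fin k)) : ℝ) * T ≠ 0 := (mul_pos hcardpos hTpos).ne'
      rw [hε_def]
      calc (Fintype.card (Option (Fin k)) : ℝ) * (1 / ((Fintype.card (Option (Fin k)) : ℝ) * T) * T)
          = ((Fintype.card (Option (Fin k)) : ℝ) * T) * (1 / ((Fintype.card (Option (Fin k)) : ℝ) * T)) := by
            ring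
        _ = 1 := mul_one_div_cancel hne
    rw [Finset.mul_sum]
    have : ∀ o ∈ Finset.univ, 2 * ((Q o + ε * T) / 2) = Q o + ε * T := fun o _ ↦ by ring
    rw [Finset.sum_congr rfl this, Finset.sum_add_distrib, Finset.sum_const, Finset.card_univ,
      nsmul_eq_mul, hcardT]
  have hcardR : (Fintype.card (Option (Fin k)) : ℝ) = (Module.finrank ℝ E : ℝ) := by
    exact_mod_cast hcard
  rw [hF₁T, hs2]
  have hfin : ∑ o, Q o - F₁ T ≤ (Module.finrank ℝ E : ℝ) * (3 * K) ^ 2 + 6 * K * G := by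
    rw [hsumQ, ← hcardR]
    exact hbound
  linarith

/-! ### §2 The comparison datum at every far point (Hopf–Rinow + the unit ball about `p`) -/

/-- **Zhang's comparison along geodesic directions, general model space**: on a complete
connected gradient shrinker `Ric + Hess f = g/2`, for every `p` there is `C` such that every `x₀`
with `d(p, x₀) ≥ 1` carries the second-order upper barriers of `datum_along` with
`2Σ q_o − df(e none) ≤ C`. `C = dim·(3K)² + 6K√G₀ + 1` with `G₀ = max |∇f|²` over the compact
unit ball about `p` (through which every minimizing geodesic from `p` runs during `[0, 1]`).
[cite: Zhang2009, Prop. 2.2 (ii) and proof of Thm. 1.3, Step 1] -/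
theorem directionalComparison_core [ConnectedSpace M] (hg : g.IsRiemannian)
    (hcpt : ∀ (x : M) (r : ℝ≥0), IsCompact {y : M | g.edist hg x y ≤ r})
    {f : M → ℝ} (hf : ContMDiff 𝓘(ℝ, E) 𝓘(ℝ, ℝ) ∞ f)
    (hsol : ∀ (x : M) (X Y : TangentSpace 𝓘(ℝ, E) x),
      g.ricci x X Y + g.hessian f x X Y = (1 / 2 : ℝ) * g.val x X Y) (p : M) :
    ∃ C : ℝ, ∀ x₀ : M, 1 ≤ (g.edist hg p x₀).toReal →
      ∃ (k : ℕ) (e : Option (Fin k) → TangentSpace 𝓘(ℝ, E) x₀) (q : Option (Fin k) → ℝ),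
        Fintype.card (Option (Fin k)) = Module.finrank ℝ E ∧
        (∀ o o', g.val x₀ (e o) (e o') = if o = o' then 1 else 0) ∧
        2 * (∑ o, q o) - mvfderiv 𝓘(ℝ, E) f x₀ (e none) ≤ C ∧
        ∀ o, ∀ᶠ s in 𝓝 (0 : ℝ),
          (g.edist hg p (expMap g.leviCivita x₀ (s • e o))).toReal ≤
            (g.edist hg p x₀).toReal + (if o = none then s else 0) + q o * s ^ 2 := by
  have hc : IsGeodesicallyComplete g.leviCivita :=
    (isGeodesicallyComplete_iff_isCompact_setOf_edist_le g le_rfl hg).2 hcpt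
  obtain ⟨K, -, hK⟩ := exists_bound_deriv_smoothTransition
  -- `G₀`: a bound for `|∇f|²` on the compact unit ball about `p`
  have hball : IsCompact {y : M | g.edist hg p y ≤ (1 : ℝ≥0)} := hcpt p 1
  have hgs : Continuous (g.gradSq f) := (contMDiff_gradSq g hf).continuous
  obtain ⟨G₀, hG₀⟩ := hball.exists_bound_of_continuousOn hgs.continuousOn
  refine ⟨Module.finrank ℝ E * (3 * K) ^ 2 + 6 * K * Real.sqrt G₀ + 1, fun x₀ hx₀ ↦ ?_⟩
  -- a minimizing segment from `p` to `x₀`, in unit speed parametrisation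
  obtain ⟨v, hmin, hq⟩ := exists_isMinimizingUpTo_of_isGeodesicallyComplete g le_rfl hg hc p x₀
  have h1 : x₀ = maximalGeodesic g.leviCivita p v 1 := by
    rw [← hq]
    exact expMap_eq_maximalGeodesic hc p v
  have hdist : g.edist hg p x₀ = ENNReal.ofReal (Real.sqrt (g.val p v v)) := by
    rw [h1, ← hmin.2, length_maximalGeodesic hg hc p v 0 1, sub_zero, one_mul]
  obtain ⟨T, hT⟩ : ∃ T : ℝ, T = (g.edist hg p x₀).toReal := ⟨_, rfl⟩
  have hTℓ : T = Real.sqrt (g.val p v v) := by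
    rw [hT, hdist, ENNReal.toReal_ofReal (Real.sqrt_nonneg _)]
  have hT1 : 1 ≤ T := hT ▸ hx₀
  have hTpos : 0 < T := by linarith
  have hvv0 : 0 ≤ g.val p v v := by
    by_cases hv : v = 0
    · simp [hv]
    · exact (hg p v hv).le
  have hvv : g.val p v v = T ^ 2 := by rw [hTℓ, Real.sq_sqrt hvv0]
  set u : TangentSpace 𝓘(ℝ, E) p := T⁻¹ • v with hu'
  have hu : g.val p u u = 1 := by
    have h2 : g.val p u u = T⁻¹ * T⁻¹ * g.val p v v := by
      rw [hu']
      simp only [map_smul, FunLike.coe_smul, Pi.smul_apply, smul_eq_mul]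
      ring
    rw [h2, hvv]
    field_simp
  have hx : expMap g.leviCivita p (T • u) = x₀ := by
    rw [hu', smul_smul, mul_inv_cancel₀ hTpos.ne', one_smul, ← riemannianExpMap_eq]
    exact hq
  subst hx
  -- the unit ball contains `γ_u[0, 1]`
  have hG₀' : ∀ t ∈ Icc (0 : ℝ) 1, g.gradSq f (expMap g.leviCivita p (t • u)) ≤ G₀ := by
    intro t ht
    have hmem : expMap g.leviCivita p (t • u) ∈ {y : M | g.edist hg p y ≤ (1 : ℝ≥0)} := by
      obtain ⟨-, -, hγ0, -⟩ := maximalGeodesic_of_isGeodesicallyComplete hc p u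
      have h := edist_maximalGeodesic_le_length hg hc p u (a := 0) (b := t) ht.1
      rw [length_maximalGeodesic hg hc p u 0 t, hu, Real.sqrt_one, mul_one, sub_zero, hγ0] at h
      show g.edist hg p (expMap g.leviCivita p (t • u)) ≤ (1 : ℝ≥0)
      rw [expMap_smul hc p u t]
      refine h.trans ?_
      rw [ENNReal.coe_one, ← ENNReal.ofReal_one]
      exact ENNReal.ofReal_le_ofReal ht.2
    have h := hG₀ _ hmem
    rw [Real.norm_eq_abs, abs_of_nonneg (g.gradSq_nonneg hg f _)] at h
    exact h
  obtain ⟨k, e, q, hcard, hon, hC, hbar⟩ := datum_along g hg hc hf hsol p u hu hT1 hK hG₀'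
  refine ⟨k, e, q, hcard, hon, hC, fun o ↦ ?_⟩
  rw [← hT]
  exact hbar o

end Core

end Literature.Geometry.Riemannian.Zhang2009

end
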